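import Mathlib
import HarnessLib
import Literature.MathematicalPhysics.QuantumLattice.KohnLuttinger
import Summits.HubbardSuperconductivity.HubbardSuperconductivity.Theorems.WeakCouplingBCSWcbcsKohnLuttingerB1gReduction

/-!
# Crux `CwKLChiralWindow` (stmt-HubbardSuperconductivity-1741), line `Sketch`: stub `stub_klMuWindow`

For the nearest-neighbour band `ε₀ = squareDispersion 1 0` (`ε₀ p = -2 (cos p₀ + cos p₁)`) the
filling is `n(μ) = 2 vol({ε₀ < μ} ∩ BZ) / (2π)²` (`BZ = [-π, π)²`) and the chemical potential of
the density `1 - δ` is `μ_δ = sInf {μ | 1 - δ ≤ n(μ)}`.  We prove `μ_δ ∈ (-4, 0)` for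
`δ ∈ [3/10, 12/25]` (so `1 - δ ∈ [13/25, 7/10]`) with two explicit discs:

* `{ε₀ < μ} ∩ BZ ⊆ B(0, 3/2)` for `μ ≤ -3` (there `cos p₀ + cos p₁ > 3/2` forces `cos pᵢ > 1/2`,
  i.e. `|pᵢ| < π/3`), whence `n(μ) ≤ 9/(8π) < 1/2 < 13/25`: every admissible `μ` is `≥ -3`;
* `B(0, 211/100) ⊆ {ε₀ < -2cos²(3/2)} ∩ BZ` (`cos p₀ + cos p₁ = 2 cos u cos v` with
  `u, v = (p₀ ± p₁)/2`, `|u|, |v| < 3/2 < π/2`, so `cos u cos v ≥ cos²(3/2) > 0`), whence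
  `n(-2cos²(3/2)) ≥ (211/100)²/π > 7/10`: the negative number `-2cos²(3/2)` is admissible.

Hence `-4 < -3 ≤ μ_δ ≤ -2cos²(3/2) < 0` (`le_csInf` / `csInf_le`).  Folklore; no definitions.
-/

noncomputable section

set_option linter.dupNamespace false

namespace Summit.HubbardSuperconductivity.HubbardSuperconductivity.Theorems

open MeasureTheory Literature.MathematicalPhysics.QuantumLattice

/-! ### The filling as a volume -/

/-- The zero-temperature occupation integral of the free band is the volume of the occupied part
of the Brillouin zone: `∫_{BZ} 𝟙[ε₀ p < μ] dp = vol({ε₀ < μ} ∩ BZ)`. [folklore] -/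
theorem kl_mu_integral_fermiOccupation (μ : ℝ) :
    ∫ p in brillouinZone, fermiOccupation (squareDispersion 1 0) μ p =
      (volume ({p : Momentum | squareDispersion 1 0 p < μ} ∩ brillouinZone)).toReal := by
  have hS : MeasurableSet {p : Momentum | squareDispersion 1 0 p < μ} :=
    measurableSet_lt (measurable_squareDispersion 1 0) measurable_const
  have hf : fermiOccupation (squareDispersion 1 0) μ =
      Set.indicator {p : Momentum | squareDispersion 1 0 p < μ} (fun _ => (1 : ℝ)) := by
    funext p
    simp only [fermiOccupation, Set.indicator, Set.mem_setOf_eq]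
  rw [hf, integral_indicator_const (1 : ℝ) hS, measureReal_restrict_apply hS, measureReal_def,
    smul_eq_mul, mul_one]

/-- The filling of the free band as a volume: `n(μ) = 2 vol({ε₀ < μ} ∩ BZ) / (2π)²`. [folklore] -/
theorem kl_mu_filling_eq (μ : ℝ) :
    KohnLuttinger.filling (squareDispersion 1 0) μ =
      2 * (volume ({p : Momentum | squareDispersion 1 0 p < μ} ∩ brillouinZone)).toReal /
        (2 * Real.pi) ^ 2 := by
  rw [KohnLuttinger.filling, kl_mu_integral_fermiOccupation]

/-- The Brillouin zone lies in the disc of radius `5`, so the occupied region has finite volume.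
[folklore] -/
theorem kl_mu_volume_occupied_lt_top (μ : ℝ) :
    volume ({p : Momentum | squareDispersion 1 0 p < μ} ∩ brillouinZone) < ⊤ := by
  refine lt_of_le_of_lt (measure_mono ?_) (measure_ball_lt_top (μ := volume)
    (x := (0 : Momentum)) (r := 5))
  intro p hp
  rw [EuclideanSpace.ball_zero_eq _ (by norm_num), Set.mem_setOf_eq, Fin.sum_univ_two]
  obtain ⟨h0a, h0b⟩ := hp.2 0
  obtain ⟨h1a, h1b⟩ := hp.2 1
  have hpi := Real.pi_lt_d2
  have hpi0 := Real.pi_pos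
  nlinarith [mul_nonneg (sub_nonneg.2 h0b.le) (by linarith : (0 : ℝ) ≤ Real.pi + p 0),
    mul_nonneg (sub_nonneg.2 h1b.le) (by linarith : (0 : ℝ) ≤ Real.pi + p 1)]

/-! ### Low energies: the occupied region below `-3` is a small disc -/

/-- If `|x| ≤ π` and `cos x > 1/2` then `|x| < π/3`. [folklore] -/
theorem kl_mu_abs_lt_of_half_lt_cos {x : ℝ} (hx : |x| ≤ Real.pi) (hc : 1 / 2 < Real.cos x) :
    |x| < Real.pi / 3 := by
  by_contra h
  push Not at h
  have := Real.cos_le_cos_of_nonneg_of_le_pi (by positivity) hx h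
  rw [Real.cos_abs, Real.cos_pi_div_three] at this
  linarith

/-- Below energy `-3` the occupied momenta of the Brillouin zone lie in the disc of radius `3/2`
(`cos p₀ + cos p₁ > 3/2` forces `cos pᵢ > 1/2`, i.e. `|pᵢ| < π/3`, and `2π²/9 < 9/4`). [folklore] -/
theorem kl_mu_occupied_subset_ball {μ : ℝ} (hμ : μ ≤ -3) :
    {p : Momentum | squareDispersion 1 0 p < μ} ∩ brillouinZone ⊆
      Metric.ball (0 : Momentum) (3 / 2) := by
  intro p hp
  obtain ⟨hp1, hp2⟩ := hp
  simp only [Set.mem_setOf_eq, squareDispersion] at hp1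
  have hsum : 3 / 2 < Real.cos (p 0) + Real.cos (p 1) := by linarith
  have hcos : ∀ i, 1 / 2 < Real.cos (p i) :=
    Fin.forall_fin_two.2 ⟨by linarith [Real.cos_le_one (p 1)], by linarith [Real.cos_le_one (p 0)]⟩
  have habs : ∀ i, |p i| < Real.pi / 3 := fun i => by
    refine kl_mu_abs_lt_of_half_lt_cos ?_ (hcos i)
    have := hp2 i
    rw [abs_le]
    exact ⟨this.1, this.2.le⟩
  have hsq : ∀ i, (p i) ^ 2 < (Real.pi / 3) ^ 2 := fun i => by
    have := abs_lt.1 (habs i)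
    exact sq_lt_sq' this.1 this.2
  rw [EuclideanSpace.ball_zero_eq _ (by norm_num), Set.mem_setOf_eq, Fin.sum_univ_two]
  have h0 := hsq 0
  have h1 := hsq 1
  have hpi := Real.pi_lt_d2
  have hpi0 := Real.pi_pos
  nlinarith

/-- For `μ ≤ -3` the filling is `< 1/2` (indeed `≤ 9/(8π)`). [folklore] -/
theorem kl_mu_filling_lt_half {μ : ℝ} (hμ : μ ≤ -3) :
    KohnLuttinger.filling (squareDispersion 1 0) μ < 1 / 2 := by
  rw [kl_mu_filling_eq]
  have hV : (volume ({p : Momentum | squareDispersion 1 0 p < μ} ∩ brillouinZone)).toReal ≤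
      (3 / 2) ^ 2 * Real.pi := by
    have h1 : volume ({p : Momentum | squareDispersion 1 0 p < μ} ∩ brillouinZone) ≤
        volume (Metric.ball (0 : Momentum) (3 / 2)) :=
      measure_mono (kl_mu_occupied_subset_ball hμ)
    have h2 : (volume (Metric.ball (0 : Momentum) (3 / 2))).toReal = (3 / 2) ^ 2 * Real.pi := by
      rw [EuclideanSpace.volume_ball_fin_two, ENNReal.toReal_mul, ENNReal.toReal_pow,
        ENNReal.toReal_ofReal (by norm_num), ENNReal.toReal_ofReal Real.pi_pos.le]
    rw [← h2]
    exact ENNReal.toReal_mono measure_ball_lt_top.ne h1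
  have hpi := Real.pi_gt_three
  rw [div_lt_iff₀ (by positivity)]
  nlinarith

/-! ### A large occupied disc at a negative energy -/

/-- `cos (3/2) > 0` (`3/2 < π/2`). [folklore] -/
theorem kl_mu_cos_three_halves_pos : 0 < Real.cos (3 / 2) :=
  Real.cos_pos_of_mem_Ioo ⟨by linarith [Real.pi_gt_three], by linarith [Real.pi_gt_three]⟩

/-- `cos u ≥ cos (3/2)` for `|u| ≤ 3/2` (`cos` is even and antitone on `[0, π]`). [folklore] -/
theorem kl_mu_cos_three_halves_le {u : ℝ} (hu : |u| ≤ 3 / 2) : Real.cos (3 / 2) ≤ Real.cos u := by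
  rw [← Real.cos_abs u]
  exact Real.cos_le_cos_of_nonneg_of_le_pi (abs_nonneg u) (by linarith [Real.pi_gt_three]) hu

/-- The disc of radius `211/100` lies in the Brillouin zone and strictly below the energy
`-2 cos²(3/2)`: there `cos p₀ + cos p₁ = 2 cos((p₀+p₁)/2) cos((p₀-p₁)/2) ≥ 2 cos²(3/2)`. [folklore] -/
theorem kl_mu_ball_subset_occupied :
    Metric.ball (0 : Momentum) (211 / 100) ⊆
      {p : Momentum | squareDispersion 1 0 p < -2 * Real.cos (3 / 2) ^ 2} ∩ brillouinZone := by
  intro p hp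
  rw [EuclideanSpace.ball_zero_eq _ (by norm_num), Set.mem_setOf_eq, Fin.sum_univ_two] at hp
  have hpi := Real.pi_gt_three
  have hc := kl_mu_cos_three_halves_pos
  refine ⟨?_, ?_⟩
  · simp only [Set.mem_setOf_eq, squareDispersion, mul_zero, zero_mul, sub_zero, mul_one]
    rw [Real.cos_add_cos]
    have hu2 : ((p 0 + p 1) / 2) ^ 2 < (3 / 2) ^ 2 := by nlinarith [sq_nonneg (p 0 - p 1)]
    have hv2 : ((p 0 - p 1) / 2) ^ 2 < (3 / 2) ^ 2 := by nlinarith [sq_nonneg (p 0 + p 1)]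
    have hu : |(p 0 + p 1) / 2| ≤ 3 / 2 := (abs_lt_of_sq_lt_sq hu2 (by norm_num)).le
    have hv : |(p 0 - p 1) / 2| ≤ 3 / 2 := (abs_lt_of_sq_lt_sq hv2 (by norm_num)).le
    have hcu := kl_mu_cos_three_halves_le hu
    have hcv := kl_mu_cos_three_halves_le hv
    have hprod : Real.cos (3 / 2) * Real.cos (3 / 2) ≤
        Real.cos ((p 0 + p 1) / 2) * Real.cos ((p 0 - p 1) / 2) :=
      mul_le_mul hcu hcv hc.le (hc.le.trans hcu)
    nlinarith [mul_pos hc hc]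
  · show ∀ i, p i ∈ Set.Ico (-Real.pi) Real.pi
    have key : ∀ x : ℝ, x ^ 2 < Real.pi ^ 2 → x ∈ Set.Ico (-Real.pi) Real.pi := fun x hx => by
      have := abs_lt_of_sq_lt_sq' hx Real.pi_pos.le
      exact ⟨this.1.le, this.2⟩
    refine Fin.forall_fin_two.2 ⟨key _ ?_, key _ ?_⟩
    · nlinarith [sq_nonneg (p 1)]
    · nlinarith [sq_nonneg (p 0)]

/-- At the negative energy `-2 cos²(3/2)` the filling exceeds `7/10`
(indeed `≥ (211/100)²/π`). [folklore] -/
theorem kl_mu_filling_gt :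
    7 / 10 < KohnLuttinger.filling (squareDispersion 1 0) (-2 * Real.cos (3 / 2) ^ 2) := by
  rw [kl_mu_filling_eq]
  have hV : (211 / 100) ^ 2 * Real.pi ≤ (volume ({p : Momentum |
      squareDispersion 1 0 p < -2 * Real.cos (3 / 2) ^ 2} ∩ brillouinZone)).toReal := by
    have h1 : volume (Metric.ball (0 : Momentum) (211 / 100)) ≤ volume ({p : Momentum |
        squareDispersion 1 0 p < -2 * Real.cos (3 / 2) ^ 2} ∩ brillouinZone) :=
      measure_mono kl_mu_ball_subset_occupied
    have h2 : (volume (Metric.ball (0 : Momentum) (211 / 100))).toReal =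
        (211 / 100) ^ 2 * Real.pi := by
      rw [EuclideanSpace.volume_ball_fin_two, ENNReal.toReal_mul, ENNReal.toReal_pow,
        ENNReal.toReal_ofReal (by norm_num), ENNReal.toReal_ofReal Real.pi_pos.le]
    rw [← h2]
    exact ENNReal.toReal_mono (kl_mu_volume_occupied_lt_top _).ne h1
  have hpi := Real.pi_lt_d2
  have hpi0 := Real.pi_pos
  rw [lt_div_iff₀ (by positivity)]
  nlinarith

/-! ### The stub -/

/-- **Stub `stub_klMuWindow`**: on the doping window the chemical potential of the free band lies
strictly inside the band, below half filling: `μ_δ = sInf {μ | 1-δ ≤ n(μ)} ∈ (-4, 0)` for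
`δ ∈ [3/10, 12/25]` (every admissible `μ` is `≥ -3` since `n ≤ 1/2` below `-3`; the negative
energy `-2cos²(3/2)` is admissible since `n(-2cos²(3/2)) > 7/10`). [folklore] -/
theorem stub_klMuWindow :
    ∀ δ ∈ Set.Icc (3/10 : ℝ) (12/25), chemicalPotentialOfDensity (squareDispersion 1 0) (1 - δ) ∈ Set.Ioo (-4 : ℝ) 0 := by
  intro δ hδ
  obtain ⟨hδ1, hδ2⟩ := hδ
  set S : Set ℝ := {μ | 1 - δ ≤ KohnLuttinger.filling (squareDispersion 1 0) μ} with hS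
  have hdef : chemicalPotentialOfDensity (squareDispersion 1 0) (1 - δ) = sInf S := rfl
  -- every admissible chemical potential is `≥ -3`
  have hlow : ∀ μ ∈ S, -3 ≤ μ := by
    intro μ hμ
    by_contra h
    push Not at h
    have hn := kl_mu_filling_lt_half h.le
    have hμ' : 1 - δ ≤ KohnLuttinger.filling (squareDispersion 1 0) μ := hμ
    linarith
  -- the negative energy `-2 cos²(3/2)` is admissible
  have hc := kl_mu_cos_three_halves_pos
  have hneg : -2 * Real.cos (3 / 2) ^ 2 < 0 := by nlinarith [mul_pos hc hc]
  have hmem : -2 * Real.cos (3 / 2) ^ 2 ∈ S := by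
    show 1 - δ ≤ KohnLuttinger.filling (squareDispersion 1 0) (-2 * Real.cos (3 / 2) ^ 2)
    have := kl_mu_filling_gt
    linarith
  rw [hdef]
  refine ⟨?_, ?_⟩
  · have : -3 ≤ sInf S := le_csInf ⟨_, hmem⟩ hlow
    linarith
  · exact lt_of_le_of_lt (csInf_le ⟨-3, hlow⟩ hmem) hneg

end Summit.HubbardSuperconductivity.HubbardSuperconductivity.Theorems

end
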